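/-
Origin: expansion seat `planner-pub-hodgecm-pv06-g3-0`, handover #11a 2026-08-18T07:45:04Z (`HOME/pub-hodgecm-pv06-g3/lean/Pv06g3/DiagonalTorusGL.lean`, md5 360f49cd, 206 lines);
landed by the gen-7 packager in gate run 26 as `HodgeCM/PerL34/DiagonalTorusGL.lean` (verbatim).
-/
/-
Copyright: pub-hodgecm cell, unit pub-hodgecm-pv06-g3 (DAG-node prover #06, gen 3). Lands as
`HodgeCM/PerL34/DiagonalTorusGL.lean` (Mathlib-only imports; nothing cited, nothing posited).
-/
import Mathlib.LinearAlgebra.Matrix.GeneralLinearGroup.Defs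
import Mathlib.Topology.Instances.Matrix
import Mathlib.Topology.Algebra.Constructions
import Mathlib.Data.Fin.VecNotation

/-!
# Diagonal tori in `GL_n`: the embedding `(Rˣ)ⁿ →* GL n R` and the unitarity identity for diagonal forms

Generic, Mathlib-level support for the torus embedding `T = U(W₁) × U(W₂) ⊂ U(W)` of PerL v5 (§3.2 l. 305,
l. 315 "`T := U(W₁) × U(W₂) ≅ U(1)²`"; `W = W₁ ⊥ W₂`, so in a basis adapted to the splitting the hermitian matrix
of `W` is DIAGONAL and `T` is the diagonal torus of `U(W) ≤ GL₂`).  For a commutative ring `R`: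

* `DiagonalTorus.diagGL n : (n → Rˣ) →* GL n R`, `u ↦ diagonal u` (`val_diagGL`, `val_inv_diagGL`), injective,
  continuous whenever `R` carries a topology (units topologies on both sides: `continuous_diagGL`);
* `DiagonalTorus.diagGL₂ : Rˣ × Rˣ →* GL (Fin 2) R`, `(u₁, u₂) ↦ diag(u₁, u₂)` (`val_diagGL₂`, `continuous_diagGL₂`,
  `diagGL₂_injective`);
* functoriality `Units.map φ.mapMatrix (diagGL n u) = diagGL n (Units.map φ ∘ u)` (`map_diagGL`, `map_diagGL₂`) — e.g. the
  diagonal embedding `GL_n(L) → GL_n(𝔸_L)` takes `diag(ℓ₁, ℓ₂)` to `diag((ℓ₁)_𝔸, (ℓ₂)_𝔸)`;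
* the **unitarity identity** for a ring endomorphism `σ` ("conjugation") and a diagonal form `H = diagonal d`:
  `((diagGL n u).map σ)ᵀ * diagonal d * diagGL n u = diagonal (fun i => σ uᵢ * dᵢ * uᵢ)`
  (`conj_transpose_mul_diagonal_mul_diagGL`), hence `= diagonal d` as soon as `uᵢ * σ uᵢ = 1` for all `i`
  (`diagGL_unitary_of_mul_conj_eq_one`, and the `Fin 2` version `diagGL₂_unitary_of_mul_conj_eq_one`): a tuple of
  "norm-one" units is a unitary diagonal matrix for EVERY diagonal hermitian form;
* diagonal matrices commute with each other (`diagGL_comm`) — the `comm`-type bookkeeping of torus data.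

The junction with the genuine adelic objects (`R = 𝔸_L`, `σ = c ⊗ id`, `uᵢ ∈ U(1)(𝔸_{L⁺})`) is a separate file on top
of this one and of the adelic unitary group / norm-one torus files.
-/

set_option autoImplicit false

open Matrix Topology

namespace HodgeCM.PerL34.DiagonalTorus

variable {R : Type*} [CommRing R]
variable (n : Type*) [Fintype n] [DecidableEq n]

/-- **The diagonal torus embedding** `(Rˣ)ⁿ →* GL n R`, `u ↦ diagonal u`. -/
def diagGL : (n → Rˣ) →* GL n R where
  toFun u :=
    { val := diagonal fun i => (u i : R)
      inv := diagonal fun i => ((u i)⁻¹ : Rˣ)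
      val_inv := by
        rw [diagonal_mul_diagonal, ← diagonal_one]
        congr 1; funext i; simp
      inv_val := by
        rw [diagonal_mul_diagonal, ← diagonal_one]
        congr 1; funext i; simp }
  map_one' := by
    ext1
    simp
  map_mul' u v := by
    ext1
    simp [diagonal_mul_diagonal]

variable {n}

/-- (Ported verbatim from the HodgeCMPerL package; no docstring in the source.) -/
@[simp]
theorem val_diagGL (u : n → Rˣ) : ((diagGL n u : GL n R) : Matrix n n R) = diagonal fun i => (u i : R) := rfl

/-- (Ported verbatim from the HodgeCMPerL package; no docstring in the source.) -/
@[simp]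
theorem val_inv_diagGL (u : n → Rˣ) :
    ((diagGL n u)⁻¹ : GL n R) = (diagonal fun i => ((u i)⁻¹ : Rˣ) : Matrix n n R) := rfl

/-- (Ported verbatim from the HodgeCMPerL package; no docstring in the source.) -/
theorem diagGL_apply_apply (u : n → Rˣ) (i j : n) :
    ((diagGL n u : GL n R) : Matrix n n R) i j = if i = j then (u i : R) else 0 := by
  rw [val_diagGL, diagonal_apply]

/-- (Ported verbatim from the HodgeCMPerL package; no docstring in the source.) -/
theorem diagGL_injective : Function.Injective (diagGL (R := R) n) := by
  intro u v h
  have h' := congrArg (fun g : GL n R => (g : Matrix n n R)) h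
  simp only [val_diagGL] at h'
  funext i
  exact Units.ext (congrFun (diagonal_injective h') i)

/-- Diagonal matrices commute. -/
theorem diagGL_comm (u v : n → Rˣ) : diagGL n u * diagGL n v = diagGL n v * diagGL n u := by
  rw [← map_mul, ← map_mul, mul_comm]

/-- Functoriality in the ring: a ring hom `φ` applied entrywise takes `diagonal u` to `diagonal (φ ∘ u)`. -/
theorem map_diagGL {S : Type*} [CommRing S] (φ : R →+* S) (u : n → Rˣ) :
    Units.map (φ.mapMatrix : Matrix n n R →+* Matrix n n S).toMonoidHom (diagGL n u) =
      diagGL n fun i => Units.map (φ : R →* S) (u i) := by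
  ext1
  simp [diagonal_map (map_zero φ)]

/-- Entrywise image of a diagonal torus element under a ring hom. -/
theorem val_diagGL_map (σ : R →+* R) (u : n → Rˣ) :
    ((diagGL n u : GL n R) : Matrix n n R).map σ = diagonal fun i => σ (u i) := by
  rw [val_diagGL, diagonal_map (map_zero σ)]

/-- **The unitarity identity for diagonal forms**: `(σ(diag u))ᵀ · diagonal d · diag u = diagonal (σ uᵢ · dᵢ · uᵢ)`. -/
theorem conj_transpose_mul_diagonal_mul_diagGL (σ : R →+* R) (d : n → R) (u : n → Rˣ) :
    (((diagGL n u : GL n R) : Matrix n n R).map σ)ᵀ * diagonal d * (diagGL n u : Matrix n n R) =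
      diagonal fun i => σ (u i) * d i * u i := by
  rw [val_diagGL_map, diagonal_transpose, val_diagGL, diagonal_mul_diagonal, diagonal_mul_diagonal]

/-- **Norm-one units are unitary for every diagonal form**: if `uᵢ · σ uᵢ = 1` for all `i` then
`(σ(diag u))ᵀ · diagonal d · diag u = diagonal d`. -/
theorem diagGL_unitary_of_mul_conj_eq_one (σ : R →+* R) (d : n → R) (u : n → Rˣ)
    (hu : ∀ i, (u i : R) * σ (u i) = 1) :
    (((diagGL n u : GL n R) : Matrix n n R).map σ)ᵀ * diagonal d * (diagGL n u : Matrix n n R) =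
      diagonal d := by
  rw [conj_transpose_mul_diagonal_mul_diagGL]
  congr 1
  funext i
  calc σ (u i) * d i * u i = d i * ((u i : R) * σ (u i)) := by ring
    _ = d i := by rw [hu i, mul_one]

section Topology

variable [TopologicalSpace R]

/-- The diagonal torus embedding is continuous (units topologies on `(Rˣ)ⁿ` and on `GL n R = (M_n R)ˣ`). -/
theorem continuous_diagGL : Continuous (diagGL (R := R) n) := by
  refine Units.continuous_iff.2 ⟨?_, ?_⟩
  · change Continuous fun u : n → Rˣ => diagonal fun i => (u i : R)
    exact (continuous_pi fun i => Units.continuous_val.comp (continuous_apply i)).matrix_diagonal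
  · change Continuous fun u : n → Rˣ => diagonal fun i => (((u i)⁻¹ : Rˣ) : R)
    exact (continuous_pi fun i => Units.continuous_coe_inv.comp (continuous_apply i)).matrix_diagonal

end Topology

/-! ## The rank-two case `(u₁, u₂) ↦ diag(u₁, u₂)` -/

/-- `Rˣ × Rˣ →* (Fin 2 → Rˣ)`, `(u₁, u₂) ↦ ![u₁, u₂]`. -/
def pairToFin2 : Rˣ × Rˣ →* (Fin 2 → Rˣ) where
  toFun u := ![u.1, u.2]
  map_one' := by
    funext i
    fin_cases i <;> rfl
  map_mul' u v := by
    funext i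
    fin_cases i <;> rfl

/-- (Ported verbatim from the HodgeCMPerL package; no docstring in the source.) -/
@[simp] theorem pairToFin2_apply (u : Rˣ × Rˣ) : pairToFin2 u = ![u.1, u.2] := rfl

/-- (Ported verbatim from the HodgeCMPerL package; no docstring in the source.) -/
theorem pairToFin2_injective : Function.Injective (pairToFin2 (R := R)) := by
  intro u v h
  have h0 := congrFun h 0
  have h1 := congrFun h 1
  simp only [pairToFin2_apply, cons_val_zero, cons_val_one] at h0 h1
  exact Prod.ext h0 h1

/-- **The diagonal torus of `GL₂`**: `Rˣ × Rˣ →* GL (Fin 2) R`, `(u₁, u₂) ↦ diag(u₁, u₂)`. -/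
def diagGL₂ : Rˣ × Rˣ →* GL (Fin 2) R := (diagGL (Fin 2)).comp pairToFin2

/-- (Ported verbatim from the HodgeCMPerL package; no docstring in the source.) -/
theorem diagGL₂_eq (u : Rˣ × Rˣ) : diagGL₂ u = diagGL (Fin 2) ![u.1, u.2] := rfl

/-- (Ported verbatim from the HodgeCMPerL package; no docstring in the source.) -/
@[simp]
theorem val_diagGL₂ (u : Rˣ × Rˣ) :
    ((diagGL₂ u : GL (Fin 2) R) : Matrix (Fin 2) (Fin 2) R) = diagonal ![(u.1 : R), (u.2 : R)] := by
  rw [diagGL₂_eq, val_diagGL]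
  congr 1
  funext i
  fin_cases i <;> rfl

/-- (Ported verbatim from the HodgeCMPerL package; no docstring in the source.) -/
theorem diagGL₂_injective : Function.Injective (diagGL₂ (R := R)) :=
  diagGL_injective.comp pairToFin2_injective

/-- (Ported verbatim from the HodgeCMPerL package; no docstring in the source.) -/
theorem diagGL₂_comm (u v : Rˣ × Rˣ) : diagGL₂ u * diagGL₂ v = diagGL₂ v * diagGL₂ u := by
  rw [← map_mul, ← map_mul, mul_comm]

/-- Functoriality: `φ (diag(u₁, u₂)) = diag(φ u₁, φ u₂)`. -/
theorem map_diagGL₂ {S : Type*} [CommRing S] (φ : R →+* S) (u : Rˣ × Rˣ) :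
    Units.map (φ.mapMatrix : Matrix (Fin 2) (Fin 2) R →+* Matrix (Fin 2) (Fin 2) S).toMonoidHom (diagGL₂ u) =
      diagGL₂ (Units.map (φ : R →* S) u.1, Units.map (φ : R →* S) u.2) := by
  rw [diagGL₂_eq, map_diagGL, diagGL₂_eq]
  congr 1
  funext i
  fin_cases i <;> rfl

/-- **Rank-two unitarity**: if `u₁ σ(u₁) = 1 = u₂ σ(u₂)` then `diag(u₁, u₂)` preserves every diagonal form
`diagonal ![d₁, d₂]`: `(σ(diag u))ᵀ · H · diag u = H`. -/
theorem diagGL₂_unitary_of_mul_conj_eq_one (σ : R →+* R) (d : Fin 2 → R) (u : Rˣ × Rˣ)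
    (h₁ : (u.1 : R) * σ u.1 = 1) (h₂ : (u.2 : R) * σ u.2 = 1) :
    (((diagGL₂ u : GL (Fin 2) R) : Matrix (Fin 2) (Fin 2) R).map σ)ᵀ * diagonal d *
        (diagGL₂ u : Matrix (Fin 2) (Fin 2) R) = diagonal d := by
  rw [diagGL₂_eq]
  refine diagGL_unitary_of_mul_conj_eq_one σ d _ fun i => ?_
  fin_cases i
  · exact h₁
  · exact h₂

section Topology

variable [TopologicalSpace R]

/-- (Ported verbatim from the HodgeCMPerL package; no docstring in the source.) -/
theorem continuous_pairToFin2 : Continuous (pairToFin2 (R := R)) := by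
  refine continuous_pi fun i => ?_
  fin_cases i
  · simpa using continuous_fst
  · simpa using continuous_snd

/-- `(u₁, u₂) ↦ diag(u₁, u₂)` is continuous. -/
theorem continuous_diagGL₂ : Continuous (diagGL₂ (R := R)) :=
  continuous_diagGL.comp continuous_pairToFin2

end Topology

end HodgeCM.PerL34.DiagonalTorus
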